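import Literature.Barriers.Parity.SiegelZeroQuadraticPolynomialsOmegaSums
import Literature.Barriers.Parity.SiegelZeroQuadraticPolynomialsInputs
import HarnessLib

/-!
# Granville–Mollin 2000, Theorem 3 for `A` odd, from Theorem 4 and Heath-Brown's Lemma 3

Topic `Literature/Barriers/Parity`, companion ("Proofs"-type, theorems only, everything PROVED) of
the catalogue entry `SiegelZeroQuadraticPolynomials.lean` (Granville–Mollin, *Rabinowitsch
revisited*, Acta Arith. 96 (2000)). It proves **Theorem 3** — "Suppose that the `L`-function
`L(s, (d/·))` with `d = 1 − 4A` has a "Siegel zero" `β` with `1 − β ≤ 1/log³|d|`, that is,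
`η ≥ log²|d|`. Then there exists an integer `N` such that there are more than `κ₃ N log|A|/log N`
primes amongst the integers `|n² + n + A|` with `n = 0, 1, …, N`" — for `A` ODD (`d ≡ 5 (mod 8)`),
for EVERY constant `κ > 0` and all `|d|` beyond a threshold depending on `κ`, from the two named facts
`Literature.Barriers.Parity.GranvilleMollin2000_thm4` (Theorem 4, vendored in the catalogue entry) and
`Literature.Barriers.Parity.GranvilleMollin2000_heathBrownLemma3` (Heath-Brown's Lemma 3 in the form
printed in §5C, `SiegelZeroQuadraticPolynomialsInputs.lean`), following the printed proof (§6B, last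
paragraph): "If `η > log² d` then take `log N = log³ d/log log d`. Then `N` is in the range of
Theorem 4. Moreover `log d/log N ≍ log log d/log² d ≪ ϱ_d` by (5.8)."

Here the window of Theorem 4 is used at its top, `N = ⌊|d|^{δη}⌋` (`δ = δ(1/2)` of the vendored
Theorem 4), where `π_{f_d}(N) ≥ ϱ_d N/2`; the effective (5.8) of the tree
(`gmRho_ge_of_weighted`: `ϱ_d ≥ e^{−25} min(1, log η/(K₁² log²|d|))`, from Heath-Brown's bound with
constant `K₁ ≥ 1`) gives `ϱ_d ≥ 2e^{−25} log log|d|/(K₁² log²|d|)` because `log η ≥ 2 log log|d|`,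
whereas `κ N log A/log N ≤ 2κN/(δη) ≤ 2κN/(δ log²|d|)` (`log A ≤ log|d|`, `log N ≥ δη log|d|/2`); the
factor `log log|d| → ∞` beats every `κ` — this is what makes the constant `κ₃` of Corollary 1′
admissible in Theorem 3 (the use made of this file in `SiegelZeroQuadraticPolynomialsCorollary1.lean`).

For `A` even (`d ≡ 1 (mod 8)`) every value of `n² + n + A` is even and Theorem 3 as printed is void;
see `SiegelZeroQuadraticPolynomialsCorollary1.lean` for the corrected transcription of the catalogue's
`GranvilleMollin2000_cor1'_thm3` and the discussion. No definition is introduced here.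

[cite: GranvilleMollin2000, Theorem 3, Theorem 4, §5C (5.8) and §6B]
-/

noncomputable section

open Finset Real
open Literature.NumberTheory.Sieve

namespace Literature.Barriers.Parity

/-! ### Small lemmas -/

/-- `π_f(N) ≤ N + 1` (the count ranges over `n = 0, …, N`). [folklore] -/
theorem polyPrimeCount_le_succ {ι : Type*} [Fintype ι] (f : ι → Polynomial ℤ) (N : ℕ) :
    polyPrimeCount f N ≤ N + 1 := by
  unfold polyPrimeCount
  exact (Finset.card_filter_le _ _).trans (by rw [Finset.card_range])

/-- From `IsNegFundOne d` and `(q : ℤ) = |d|`: `d = −q`, `q ≡ 3 (mod 4)`, `q ≥ 3`, `|(d : ℝ)| = q`.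
[folklore] -/
theorem eq_neg_of_isNegFundOne {d : ℤ} (hd : IsNegFundOne d) {q : ℕ} (hq : (q : ℤ) = |d|) :
    d = -(q : ℤ) ∧ q % 4 = 3 ∧ 3 ≤ q ∧ |(d : ℝ)| = q := by
  obtain ⟨hdneg, -, hd4⟩ := hd
  have hdq : d = -(q : ℤ) := by rw [abs_of_neg hdneg] at hq; omega
  refine ⟨hdq, by omega, by omega, ?_⟩
  rw [hdq]; push_cast; rw [abs_neg, Nat.abs_cast]

/-- `0 ≤ log A ≤ log q` for `A = (1 − d)/4`, `d = −q`, `q ≥ 3` (`1 ≤ A ≤ q`). [folklore] -/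
theorem log_rabinowitschA_bounds {d : ℤ} {q : ℕ} (hdq : d = -(q : ℤ)) (hq : 3 ≤ q) :
    0 ≤ Real.log (((1 - d) / 4 : ℤ) : ℝ) ∧ Real.log (((1 - d) / 4 : ℤ) : ℝ) ≤ Real.log q := by
  have hA1 : (1 : ℤ) ≤ (1 - d) / 4 := by rw [hdq]; omega
  have hAq : (1 - d) / 4 ≤ (q : ℤ) := by rw [hdq]; omega
  have hA1r : (1 : ℝ) ≤ (((1 - d) / 4 : ℤ) : ℝ) := by exact_mod_cast hA1
  have hAqr : (((1 - d) / 4 : ℤ) : ℝ) ≤ (q : ℝ) := by exact_mod_cast hAq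
  exact ⟨Real.log_nonneg hA1r, Real.log_le_log (by linarith) hAqr⟩

/-- `25 ≤ e⁴`. [folklore] -/
theorem twentyfive_le_exp_four : (25 : ℝ) ≤ Real.exp 4 := by
  have h1 : (2.7182818283 : ℝ) < Real.exp 1 := Real.exp_one_gt_d9
  have h4 : Real.exp 4 = Real.exp 1 ^ 4 := by rw [← Real.exp_nat_mul]; norm_num
  rw [h4]
  have h0 : (0 : ℝ) ≤ 2.7182818283 := by norm_num
  have h := pow_le_pow_left₀ h0 h1.le 4
  have : (25 : ℝ) ≤ (2.7182818283 : ℝ) ^ 4 := by norm_num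
  exact this.trans h

/-! ### The point `N = ⌊q^e⌋` at the top of the window -/

/-- For `q ≥ 2` and `e ≥ 11`, `N = ⌊q^e⌋` satisfies `N ≥ 2`, `q^{10} ≤ N ≤ q^e` and
`log N ≥ e log q/2`. [folklore] -/
theorem floor_rpow_window {q : ℕ} (hq : 2 ≤ q) {e : ℝ} (he : 11 ≤ e) :
    2 ≤ ⌊(q : ℝ) ^ e⌋₊ ∧ (q : ℝ) ^ (10 : ℝ) ≤ ((⌊(q : ℝ) ^ e⌋₊ : ℕ) : ℝ) ∧
      ((⌊(q : ℝ) ^ e⌋₊ : ℕ) : ℝ) ≤ (q : ℝ) ^ e ∧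
        e * Real.log q / 2 ≤ Real.log ((⌊(q : ℝ) ^ e⌋₊ : ℕ) : ℝ) := by
  have hqR : (2 : ℝ) ≤ q := by exact_mod_cast hq
  have hq0 : (0 : ℝ) < q := by linarith
  have hq1 : (1 : ℝ) ≤ q := by linarith
  set N : ℕ := ⌊(q : ℝ) ^ e⌋₊ with hN_def
  have hpow0 : 0 ≤ (q : ℝ) ^ e := Real.rpow_nonneg hq0.le _
  have hNle : (N : ℝ) ≤ (q : ℝ) ^ e := Nat.floor_le hpow0
  have hNlt : (q : ℝ) ^ e < N + 1 := Nat.lt_floor_add_one _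
  have h10le : (q : ℝ) ^ (10 : ℝ) ≤ (q : ℝ) ^ e :=
    Real.rpow_le_rpow_of_exponent_le hq1 (by linarith)
  have h10nat : (q : ℝ) ^ (10 : ℝ) = ((q ^ 10 : ℕ) : ℝ) := by
    rw [show (10 : ℝ) = ((10 : ℕ) : ℝ) by norm_num, Real.rpow_natCast, Nat.cast_pow]
  have hqN : q ^ 10 ≤ N := Nat.le_floor (by rw [← h10nat]; exact h10le)
  have hN2 : 2 ≤ N := le_trans (le_trans hq (Nat.le_self_pow (by norm_num) q)) hqN
  have hNR : (2 : ℝ) ≤ N := by exact_mod_cast hN2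
  have hN0 : (0 : ℝ) < N := by linarith
  refine ⟨hN2, by rw [h10nat]; exact_mod_cast hqN, hNle, ?_⟩
  have h2N : (q : ℝ) ^ e < 2 * N := by linarith
  have hlog2N : e * Real.log q < Real.log 2 + Real.log N := by
    have h := Real.log_lt_log (Real.rpow_pos_of_pos hq0 _) h2N
    rwa [Real.log_rpow hq0, Real.log_mul (by norm_num) hN0.ne'] at h
  have hlog2 : Real.log 2 ≤ Real.log q := Real.log_le_log (by norm_num) hqR
  have hlog2pos : 0 < Real.log 2 := Real.log_pos (by norm_num)
  have h11 : 11 * Real.log 2 ≤ e * Real.log q := mul_le_mul he hlog2 hlog2pos.le (by linarith)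
  linarith

/-! ### (5.8) with `log η ≥ 2 log log q` -/

/-- **`ϱ_d ≥ 2e^{−25} log log q/(K₁² log² q)`** for `d = −q`, `q ≡ 3 (mod 8)`, `q ≥ 25`,
`log q ≥ 4`, `log log q ≥ 2K₁²`, `η ≥ log² q`, under Heath-Brown's bound
`∑_{p ≤ q^500} ω(p) log p/p ≤ K₁ log q/√(log η)` (`K₁ ≥ 1`): the tree's effective (5.8)
`gmRho_ge_of_weighted` with `min(1, log η/(K₁² log² q)) ≥ 2 log log q/(K₁² log² q)`.
[cite: GranvilleMollin2000, §5C (5.8) and §6B (proof of Theorem 3)] -/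
theorem gmRho_ge_loglog {d : ℤ} {q : ℕ} (hdq : d = -(q : ℤ)) (hq8 : q % 8 = 3) (hq25 : 25 ≤ q)
    {K₁ η : ℝ} (hK₁ : 1 ≤ K₁) (hL4 : 4 ≤ Real.log q) (hlogL : 2 * K₁ ^ 2 ≤ Real.log (Real.log q))
    (hηL2 : Real.log q ^ 2 ≤ η)
    (hH : ∑ p ∈ Nat.primesLE ⌊(q : ℝ) ^ (500 : ℝ)⌋₊,
        (polyRootCountMod ![rabinowitschPoly d] p : ℝ) * Real.log p / p ≤
      K₁ * (Real.log q / Real.sqrt (Real.log η))) :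
    Real.exp (-25) * (2 * Real.log (Real.log q) / (K₁ ^ 2 * Real.log q ^ 2)) ≤ gmRho d := by
  set L := Real.log q with hL_def
  have hL0 : 0 < L := by linarith
  have hK2 : (1 : ℝ) ≤ K₁ ^ 2 := by nlinarith
  have hlogη : 2 * Real.log L ≤ Real.log η := by
    have h : Real.log (L ^ 2) = 2 * Real.log L := by rw [Real.log_pow]; norm_num
    rw [← h]; exact Real.log_le_log (by positivity) hηL2
  have hlogη4 : 4 * K₁ ^ 2 ≤ Real.log η := by linarith
  have hρ := gmRho_ge_of_weighted hdq hq8 hq25 hK₁ hlogη4 hH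
  have hm : 2 * Real.log L / (K₁ ^ 2 * L ^ 2) ≤ min 1 (Real.log η / (K₁ ^ 2 * L ^ 2)) := by
    refine le_min ?_ (div_le_div_of_nonneg_right hlogη (by positivity))
    rw [div_le_one (by positivity)]
    have h1 : Real.log L ≤ L := (Real.log_le_sub_one_of_pos hL0).trans (by linarith)
    have h3a : 2 ≤ K₁ ^ 2 * L := by nlinarith
    have h3 : 2 * L ≤ K₁ ^ 2 * L ^ 2 := by
      calc 2 * L ≤ K₁ ^ 2 * L * L := mul_le_mul_of_nonneg_right h3a hL0.le
        _ = K₁ ^ 2 * L ^ 2 := by ring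
    linarith
  exact le_trans (mul_le_mul_of_nonneg_left hm (Real.exp_pos _).le) hρ

/-! ### The final comparison (real bookkeeping) -/

/-- The inequality that concludes Theorem 3: with `log N ≥ δηL/2`, `0 ≤ log A ≤ L`, `η ≥ L²`,
`ϱ ≥ e^{−25} · 2ℓ/(K₁²L²)`, `π ≥ ϱN/2` and `2κK₁² < e^{−25} δ ℓ` (`ℓ = log L`),
`κ N log A/log N ≤ 2κN/(δη) ≤ 2κN/(δL²) < e^{−25} ℓ N/(K₁²L²) ≤ ϱN/2 ≤ π`. [folklore] -/
theorem thm3_final_comparison {κ δ K₁ ℓ L η Nr P ϱ lA lN : ℝ} (hκ : 0 < κ) (hδ : 0 < δ)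
    (hK₁ : 0 < K₁) (hL : 0 < L) (hN : 0 < Nr) (hηL2 : L ^ 2 ≤ η)
    (hlN : δ * η * L / 2 ≤ lN) (hlA0 : 0 ≤ lA) (hlAL : lA ≤ L)
    (hϱ : Real.exp (-25) * (2 * ℓ / (K₁ ^ 2 * L ^ 2)) ≤ ϱ) (hP : ϱ * Nr / 2 ≤ P)
    (hkey : 2 * κ * K₁ ^ 2 < Real.exp (-25) * δ * ℓ) :
    κ * Nr * lA / lN < P := by
  have hη0 : 0 < η := lt_of_lt_of_le (by positivity) hηL2
  have hden : 0 < δ * η * L / 2 := by positivity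
  have step1 : κ * Nr * lA / lN ≤ 2 * κ * Nr / (δ * η) := by
    calc κ * Nr * lA / lN ≤ κ * Nr * lA / (δ * η * L / 2) :=
          div_le_div_of_nonneg_left (by positivity) hden hlN
      _ ≤ κ * Nr * L / (δ * η * L / 2) :=
          div_le_div_of_nonneg_right (mul_le_mul_of_nonneg_left hlAL (by positivity)) hden.le
      _ = 2 * κ * Nr / (δ * η) := by field_simp
  have step2 : 2 * κ * Nr / (δ * η) ≤ 2 * κ * Nr / (δ * L ^ 2) :=
    div_le_div_of_nonneg_left (by positivity) (by positivity) (mul_le_mul_of_nonneg_left hηL2 hδ.le)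
  have step3 : 2 * κ * Nr / (δ * L ^ 2) <
      Real.exp (-25) * (2 * ℓ / (K₁ ^ 2 * L ^ 2)) * Nr / 2 := by
    have h1 : Real.exp (-25) * (2 * ℓ / (K₁ ^ 2 * L ^ 2)) * Nr / 2 =
        Real.exp (-25) * δ * ℓ * Nr / (δ * K₁ ^ 2 * L ^ 2) := by
      field_simp
    rw [h1, div_lt_div_iff₀ (by positivity) (by positivity)]
    have h2 : 2 * κ * Nr * (δ * K₁ ^ 2 * L ^ 2) = (2 * κ * K₁ ^ 2) * (Nr * (δ * L ^ 2)) := by ring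
    have h3 : Real.exp (-25) * δ * ℓ * Nr * (δ * L ^ 2) =
        (Real.exp (-25) * δ * ℓ) * (Nr * (δ * L ^ 2)) := by ring
    rw [h2, h3]
    exact mul_lt_mul_of_pos_right hkey (by positivity)
  have step4 : Real.exp (-25) * (2 * ℓ / (K₁ ^ 2 * L ^ 2)) * Nr / 2 ≤ ϱ * Nr / 2 := by
    have := mul_le_mul_of_nonneg_right hϱ hN.le
    linarith
  linarith

/-! ### Theorem 3 (`A` odd) -/

/-- **Granville–Mollin, Theorem 3 for `d ≡ 5 (mod 8)`, from Theorem 4 and Heath-Brown's Lemma 3**,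
for every `κ > 0`: there is `d₀` such that for every negative fundamental `d ≡ 5 (mod 8)` with
`|d| ≥ d₀` and every real zero `1 − 1/(η log|d|)` of `L(s, (d/·))` with `η ≥ log²|d|`, some `N ≥ 2`
has `π_{f_d}(N) > κ N log A/log N`, `A = (1 − d)/4`. Thresholds: `L = log|d| ≥ L₀` with `L₀ ≥ 4`,
`L₀ ≥ η₀` (Heath-Brown), `L₀ ≥ e^{2K₁²}`, `L₀ ≥ 11/δ` and `log L₀ > 4κK₁²e^{25}/δ`; `|d| ≥ d₀` of
Theorem 4 (`ε = 1/2`) and of the Lemma; `N = ⌊|d|^{δη}⌋` (`floor_rpow_window`, `gmRho_ge_loglog`,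
`thm3_final_comparison`). [cite: GranvilleMollin2000, Theorem 3, §5C (5.8) and §6B] -/
theorem GranvilleMollin2000_thm3_odd_of_thm4 (h4 : GranvilleMollin2000_thm4)
    (hHB : GranvilleMollin2000_heathBrownLemma3) {κ : ℝ} (hκ : 0 < κ) :
    ∃ d₀ : ℝ, ∀ d : ℤ, IsNegFundOne d → d % 8 = 5 → d₀ ≤ |(d : ℝ)| →
      ∀ (q : ℕ) [NeZero q], (q : ℤ) = |d| → ∀ χ : DirichletCharacter ℂ q, χ.IsPrimitive →
        χ.IsQuadratic → ∀ η : ℝ, Real.log |(d : ℝ)| ^ 2 ≤ η →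
          χ.LFunction ((1 - 1 / (η * Real.log |(d : ℝ)|) : ℝ) : ℂ) = 0 →
            ∃ N : ℕ, 2 ≤ N ∧
              κ * N * Real.log (((1 - d) / 4 : ℤ) : ℝ) / Real.log N <
                (polyPrimeCount ![rabinowitschPoly d] N : ℝ) := by
  obtain ⟨δ, hδ, d₁, H4⟩ := h4 (1 / 2) one_half_pos
  obtain ⟨K, η₀, d₂, HB⟩ := hHB
  set K₁ : ℝ := max K 1 with hK₁_def
  have hK₁ : 1 ≤ K₁ := le_max_right _ _
  have hKK₁ : K ≤ K₁ := le_max_left _ _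
  set T : ℝ := 4 * κ * K₁ ^ 2 * Real.exp 25 / δ with hT_def
  -- threshold `L₀` on `L = log q`
  obtain ⟨L₀, hL₀4, hL₀η, hL₀K, hL₀δ, hL₀T⟩ : ∃ L₀ : ℝ, 4 ≤ L₀ ∧ η₀ ≤ L₀ ∧
      Real.exp (2 * K₁ ^ 2) ≤ L₀ ∧ 11 / δ ≤ L₀ ∧ Real.exp T < L₀ := by
    refine ⟨max (max (max (max 4 η₀) (Real.exp (2 * K₁ ^ 2))) (11 / δ)) (Real.exp T + 1),
      ?_, ?_, ?_, ?_, ?_⟩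
    · exact le_trans (le_trans (le_trans (le_max_left _ _) (le_max_left _ _)) (le_max_left _ _))
        (le_max_left _ _)
    · exact le_trans (le_trans (le_trans (le_max_right _ _) (le_max_left _ _)) (le_max_left _ _))
        (le_max_left _ _)
    · exact le_trans (le_trans (le_max_right _ _) (le_max_left _ _)) (le_max_left _ _)
    · exact le_trans (le_max_right _ _) (le_max_left _ _)
    · exact lt_of_lt_of_le (lt_add_one _) (le_max_right _ _)
  refine ⟨max (max d₁ d₂) (Real.exp L₀), ?_⟩
  intro d hd hd8 hdd q _ hq χ hχp hχq η hη hzero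
  obtain ⟨hdq, -, hq3, habs⟩ := eq_neg_of_isNegFundOne hd hq
  have hq8 : q % 8 = 3 := by omega
  -- sizes of `q` and `L = log q`
  have hd₁ : d₁ ≤ |(d : ℝ)| := le_trans (le_trans (le_max_left _ _) (le_max_left _ _)) hdd
  have hd₂ : d₂ ≤ |(d : ℝ)| := le_trans (le_trans (le_max_right _ _) (le_max_left _ _)) hdd
  have hexp : Real.exp L₀ ≤ (q : ℝ) := by rw [← habs]; exact le_trans (le_max_right _ _) hdd
  have hq0 : (0 : ℝ) < q := lt_of_lt_of_le (Real.exp_pos _) hexp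
  set L : ℝ := Real.log q with hL_def
  have hL : L₀ ≤ L := (Real.le_log_iff_exp_le hq0).mpr hexp
  have hL4 : 4 ≤ L := hL₀4.trans hL
  have hL0 : 0 < L := by linarith
  have hq25R : (25 : ℝ) ≤ q :=
    le_trans twentyfive_le_exp_four ((Real.exp_le_exp.mpr hL₀4).trans hexp)
  have hq25 : 25 ≤ q := by exact_mod_cast hq25R
  have hq2 : 2 ≤ q := by omega
  -- `η ≥ L² ≥ L ≥ η₀`, `log L ≥ 2K₁²`
  have hηL2 : L ^ 2 ≤ η := by rw [hL_def, ← habs]; exact hη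
  have hLL : L ≤ L ^ 2 := by nlinarith
  have hηL : L ≤ η := hLL.trans hηL2
  have hηη₀ : η₀ ≤ η := (hL₀η.trans hL).trans hηL
  have hlogL : 2 * K₁ ^ 2 ≤ Real.log L := (Real.le_log_iff_exp_le hL0).mpr (hL₀K.trans hL)
  -- Heath-Brown's Lemma 3 (constant weakened to `K₁ ≥ 1`) and (5.8)
  have hHBd := HB d hd hd₂ q hq χ hχp hχq η hηη₀ hzero
  rw [habs] at hHBd
  have hsq0 : 0 ≤ Real.log q / Real.sqrt (Real.log η) := div_nonneg hL0.le (Real.sqrt_nonneg _)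
  have hρ := gmRho_ge_loglog hdq hq8 hq25 hK₁ hL4 hlogL hηL2
    (hHBd.trans (mul_le_mul_of_nonneg_right hKK₁ hsq0))
  -- the point `N`
  have hδη : 11 ≤ δ * η := by
    have h11 : 11 ≤ δ * L := by rw [mul_comm]; exact (div_le_iff₀ hδ).mp (hL₀δ.trans hL)
    have h1 : δ * L ≤ δ * η := mul_le_mul_of_nonneg_left hηL hδ.le
    linarith
  obtain ⟨hN2, hN10, hNle, hlogN⟩ := floor_rpow_window hq2 hδη
  set N : ℕ := ⌊(q : ℝ) ^ (δ * η)⌋₊ with hN_def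
  have hNR : (2 : ℝ) ≤ N := by exact_mod_cast hN2
  have hN0 : (0 : ℝ) < N := by linarith
  -- Theorem 4 at `N`: `π ≥ ϱ N/2`
  have e4 := H4 d hd hd₁ q hq χ hχp hχq η (by rw [habs]; exact hηL) hzero N
    (by rw [habs]; exact hN10) (by rw [habs]; exact hNle)
  have hπ : gmRho d * N / 2 ≤ (polyPrimeCount ![rabinowitschPoly d] N : ℝ) := by
    have := (abs_le.mp e4).1
    linarith
  -- `0 ≤ log A ≤ L` and the key inequality `2κK₁² < e^{-25} δ log L`
  obtain ⟨hlogA0, hlogAL⟩ := log_rabinowitschA_bounds hdq hq3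
  have hTL : T < Real.log L := (Real.lt_log_iff_exp_lt hL0).mpr (hL₀T.trans_le hL)
  have hkey : 2 * κ * K₁ ^ 2 < Real.exp (-25) * δ * Real.log L := by
    have h1 : 4 * κ * K₁ ^ 2 * Real.exp 25 < Real.log L * δ := (div_lt_iff₀ hδ).mp hTL
    have hE : Real.exp (-25) * Real.exp 25 = 1 := by rw [← Real.exp_add]; norm_num
    have h2 := mul_lt_mul_of_pos_left h1 (Real.exp_pos (-25))
    have h3 : Real.exp (-25) * (4 * κ * K₁ ^ 2 * Real.exp 25) = 4 * κ * K₁ ^ 2 := by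
      calc Real.exp (-25) * (4 * κ * K₁ ^ 2 * Real.exp 25)
          = 4 * κ * K₁ ^ 2 * (Real.exp (-25) * Real.exp 25) := by ring
        _ = 4 * κ * K₁ ^ 2 := by rw [hE, mul_one]
    have h4 : Real.exp (-25) * (Real.log L * δ) = Real.exp (-25) * δ * Real.log L := by ring
    have hpos : 0 < κ * K₁ ^ 2 := by positivity
    linarith
  refine ⟨N, hN2, ?_⟩
  have hlogN' : δ * η * L / 2 ≤ Real.log N := by
    have : δ * η * L / 2 = δ * η * Real.log q / 2 := by rw [hL_def]
    rw [this]; exact hlogN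
  exact thm3_final_comparison hκ hδ (by linarith) hL0 hN0 hηL2 hlogN' hlogA0 hlogAL hρ hπ hkey

end Literature.Barriers.Parity
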